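import Summits.MatrixMultiplication.MatrixMultiplication.Theorems.SaturationLadderCornerBand
import Summits.MatrixMultiplication.MatrixMultiplication.Theorems.SaturationLadderTwinFamilyY64
import Summits.MatrixMultiplication.MatrixMultiplication.Theorems.SaturationLadderTowerLimit
import HarnessLib

/-!
# SaturationLadder — Kernel XXVIII (iv): tail clauses at the FLAT rate `log θ(κ)` of every band member

Support for the deciding crux `SubexpSaturation` (h₁, item 25909) of `Theses/SaturationLadder.lean`
(cell `decomp-mm`, lens «grading / quantitative ladder», gen 56).  No definitions, no named facts,
no `sorry`.  Companion of `…CornerBand` / `…CornerFamily`.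

For a FIXED pencil member `κ = p/q` with `4/5 ≤ κ ≤ 1` the exact points `(t_j, r_j)` of
`band_tight` (all `j` from the band onset `j_A(κ) = min{j ≥ 16 : c₁(κ) j + 2 ≤ j² δ(κ)}` on —
the band condition is monotone in `j`, `band_mono`) interpolate, by monotonicity of `t ↦ ω(1,t,r)`,
to the TAIL CLAUSE

  `∀ t ∈ [t_{j_A}, 1)  ∃ r ∈ [1, e^{C/(1−t)}],  ω(1,t,r) = 1 + r`,   `C = log θ(κ) = (1 + 2κ/3) log 2`

(`memberClause`) — the rate is FLAT (no `+ O(1/j)`): `r_{j+1} ≤ (2/3)·2^{j+2}` and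
`(j+2) log 2 − log(3/2) ≤ log θ(κ)/(1 − t_j)` for every `j` as soon as `κ ≥ 4/5` (`rate_flat`; the
`j`-coefficient of the difference is `4p(p+q) log 2 − 3q(3q+2p) log(4/3) ≥ 0.0216 q²`).  Table
(`clause_p_q`): onsets and rates

  `κ = 1     : t ≥ 200/221           = 0.90498,  C = 1.1553  (j_A = 16)`
  `κ = 6/7   : t ≥ 55335/57044       = 0.97004,  C = 1.0893  (j_A = 51)`
  `κ = 5/6   : t ≥ 25576/26009       = 0.98335,  C = 1.0783  (j_A = 92)`
  `κ = 9/11  : t ≥ 251823/253820     = 0.99213,  C = 1.0713  (j_A = 195)`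
  `κ = 13/16 : t ≥ 2747264/2759799   = 0.99546,  C = 1.0687  (j_A = 338)`
  `κ = 21/26 : t ≥ 31683665/31737772 = 0.99830,  C = 1.0664  (j_A = 901)`

descending to the class ceiling `c₂ = 1.06505…` (`…CornerFamily.classCeiling_bounds`); the previous
explicit tail clause was `twinClause_109`/`familyClause` at `47 log 2/30 = 1.0859` (κ = 17/20,
`Theorems/SaturationLadderUniform109.lean`).  These are TAIL clauses, not uniform ones: a `U(C)` for
`C < 1.0859` needs windows on `[0, t_{j_A})` (not attempted here).

References: D. Coppersmith, S. Winograd, J. Symbolic Comput. 9 (1990) §8 (key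
`CoppersmithWinograd1990`); J. Alman, R. Duan, V. Vassilevska Williams, Y. Xu, Z. Xu, R. Zhou, SODA
2025, §3.4 (key `AlmanDuanVassilevskaWilliamsXuXuZhou2025`).
-/

set_option linter.dupNamespace false
-- (single-conjunct summit: the namespace repeats `MatrixMultiplication`)

noncomputable section

namespace Summit.MatrixMultiplication.MatrixMultiplication.Theorems.SaturationLadderBandClauses

open Literature.Computability.AlgebraicComplexity
open Summit.MatrixMultiplication.MatrixMultiplication.Theorems.SaturationLadderCornerBand
  (band_tight r_le_two_thirds)
open Summit.MatrixMultiplication.MatrixMultiplication.Theorems.SaturationLadderTwinCeilingPencil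
  (le_cnt_aux two_q_le tEq one_sub_t one_sub_t_le)
open Summit.MatrixMultiplication.MatrixMultiplication.Theorems.SaturationLadderTwinCeiling
  (one_le_r)
open Summit.MatrixMultiplication.MatrixMultiplication.Theorems.SaturationLadderTowerLimit
  (thinTight_of_le)
open Summit.MatrixMultiplication.MatrixMultiplication.Theorems.SaturationLadderTwinFamilyY64
  (log_five_halves_le_d7)

/-! ## The band condition is monotone in `j` -/

/-- If `c x₀ + 2 ≤ x₀² δ` with `x₀ > 0`, `c ≥ 0`, then `c x + 2 ≤ x² δ` for every `x ≥ x₀`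
(`x₀ δ ≥ c`, so `x²δ − cx − 2` increases). [folklore] -/
theorem band_mono {c δ x₀ x : ℝ} (hx₀ : 0 < x₀) (hc : 0 ≤ c) (hA₀ : c * x₀ + 2 ≤ x₀ ^ 2 * δ)
    (hx : x₀ ≤ x) : c * x + 2 ≤ x ^ 2 * δ := by
  have hδ : 0 < δ := by nlinarith
  have h1 : c ≤ x₀ * δ := by
    have h : c * x₀ ≤ (x₀ * δ) * x₀ := by nlinarith
    exact le_of_mul_le_mul_right h hx₀
  have e : x ^ 2 * δ - (c * x + 2) =
      (x₀ ^ 2 * δ - (c * x₀ + 2)) + (x - x₀) * ((x + x₀) * δ - c) := by ring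
  have hxδ : 0 ≤ x * δ := mul_nonneg (by linarith) hδ.le
  have h2 : 0 ≤ (x - x₀) * ((x + x₀) * δ - c) := mul_nonneg (by linarith) (by nlinarith)
  nlinarith [e, h2, hA₀]

/-- `c₁(κ) = (1+κ) log(5/2) + (1−κ) log 2 ≥ 0` for `κ ≤ 1`. [folklore] -/
theorem c₁_nonneg {κ : ℝ} (hκ0 : 0 ≤ κ) (hκ1 : κ ≤ 1) :
    0 ≤ (1 + κ) * Real.log (5 / 2) + (1 - κ) * Real.log 2 := by
  have hP : 0 < Real.log (5 / 2) := Real.log_pos (by norm_num)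
  have hL : 0 < Real.log 2 := Real.log_pos one_lt_two
  have h1 : 0 ≤ (1 + κ) * Real.log (5 / 2) := by positivity
  have h2 : 0 ≤ (1 - κ) * Real.log 2 := mul_nonneg (by linarith) hL.le
  linarith

/-! ## The flat rate -/

/-- `0.4054 ≤ log(3/2)` (ten Taylor terms of `−log(1 − 1/3)`). [folklore] -/
theorem le_log_three_halves : (0.4054 : ℝ) ≤ Real.log (3 / 2) := by
  have h := Real.abs_log_sub_add_sum_range_le (x := (1 / 3 : ℝ))
    (by rw [abs_of_pos (by norm_num)]; norm_num) 10
  rw [abs_le] at h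
  have h2 := h.2
  simp only [Finset.sum_range_succ, Finset.sum_range_zero] at h2
  norm_num [abs_of_pos] at h2
  have e : Real.log (3 / 2 : ℝ) = -Real.log (2 / 3) := by
    rw [← Real.log_inv]; norm_num
  rw [e]; linarith

/-- `(2/3)·2^{m+2} ≤ e^y` once `(m+2) log 2 − log(3/2) ≤ y`. [folklore] -/
theorem two_thirds_pow_le_exp {m : ℕ} {y : ℝ}
    (hy : ((m : ℝ) + 2) * Real.log 2 - Real.log (3 / 2) ≤ y) :
    2 / 3 * (2 : ℝ) ^ (m + 2) ≤ Real.exp y := by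
  have e2 : Real.exp (((m : ℝ) + 2) * Real.log 2) = (2 : ℝ) ^ (m + 2) := by
    rw [show ((m : ℝ) + 2) = ((m + 2 : ℕ) : ℝ) by push_cast; ring, Real.exp_nat_mul,
      Real.exp_log two_pos]
  have e : 2 / 3 * (2 : ℝ) ^ (m + 2) = Real.exp (((m : ℝ) + 2) * Real.log 2 - Real.log (3 / 2)) := by
    rw [Real.exp_sub, Real.exp_log (by norm_num : (0 : ℝ) < 3 / 2), e2]; ring
  rw [e]; exact Real.exp_le_exp.2 hy

/-- **Flat rate.**  For `4q ≤ 5p` (`0 < q`) and every `m`: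
`(m+2) log 2 − log(3/2) ≤ (log θ(p/q)) / (1 − t_m)`, `log θ = ((3q+2p)/(3q)) log 2`,
`1 − t_m = ((3q+2p) m + 2q+2p)/((m+1)(3qm+2q+2p))`; i.e.
`3q((3q+2p)m + 2q+2p)((m+2) log 2 − log(3/2)) ≤ (3q+2p) log 2 (m+1)(3qm+2q+2p)`, whose `m`-coefficient
is `4p(p+q) log 2 − 3q(3q+2p) log(4/3) ≥ 0.0216 q²` and constant `(2q+2p)(2p log 2 − 3q log(4/3)) > 0`.
[folklore] -/
theorem rate_flat (p q m : ℕ) (hq : 0 < q) (h45 : 4 * q ≤ 5 * p) :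
    ((m : ℝ) + 2) * Real.log 2 - Real.log (3 / 2) ≤
      ((3 * (q : ℝ) + 2 * p) / (3 * q) * Real.log 2) /
        (((3 * (q : ℝ) + 2 * p) * m + 2 * q + 2 * p) / (((m : ℝ) + 1) * (3 * q * m + 2 * q + 2 * p))) := by
  have hq' : (0 : ℝ) < q := by exact_mod_cast hq
  have hp0 : (0 : ℝ) ≤ p := Nat.cast_nonneg _
  have hm0 : (0 : ℝ) ≤ m := Nat.cast_nonneg _
  have h45' : 4 * (q : ℝ) ≤ 5 * p := by exact_mod_cast h45
  have hs : 0 ≤ (p : ℝ) - 4 / 5 * q := by linarith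
  have hl2 := Real.log_two_gt_d9
  have hl2' := Real.log_two_lt_d9
  have hℓ := le_log_three_halves
  have hD : (0 : ℝ) < (3 * (q : ℝ) + 2 * p) * m + 2 * q + 2 * p := by positivity
  have hE : (0 : ℝ) < ((m : ℝ) + 1) * (3 * q * m + 2 * q + 2 * p) := by positivity
  -- the polynomial inequality
  have hA1 : 3 * (q : ℝ) * (3 * q + 2 * p) * (Real.log 2 - Real.log (3 / 2)) ≤
      3 * (q : ℝ) * (3 * q + 2 * p) * 0.2877471808 :=
    mul_le_mul_of_nonneg_left (by linarith) (by positivity)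
  have hA2 : 2 * (p : ℝ) * (2 * q + 2 * p) * 0.6931471803 ≤ 2 * (p : ℝ) * (2 * q + 2 * p) * Real.log 2 :=
    mul_le_mul_of_nonneg_left hl2.le (by positivity)
  have hA : 0 ≤ 2 * (p : ℝ) * (2 * q + 2 * p) * Real.log 2 -
      3 * (q : ℝ) * (3 * q + 2 * p) * (Real.log 2 - Real.log (3 / 2)) := by
    nlinarith [mul_nonneg hs hs, mul_nonneg hs hq'.le, mul_pos hq' hq', hA1, hA2]
  have hB1 : 2 * (p : ℝ) * 0.6931471803 ≤ 2 * (p : ℝ) * Real.log 2 :=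
    mul_le_mul_of_nonneg_left hl2.le (by positivity)
  have hB2 : 3 * (q : ℝ) * (Real.log 2 - Real.log (3 / 2)) ≤ 3 * (q : ℝ) * 0.2877471808 :=
    mul_le_mul_of_nonneg_left (by linarith) (by positivity)
  have hB : 0 ≤ (2 * (q : ℝ) + 2 * p) * (2 * p * Real.log 2 - 3 * q * (Real.log 2 - Real.log (3 / 2))) :=
    mul_nonneg (by positivity) (by linarith)
  have key : 3 * (q : ℝ) * (((3 * q + 2 * p) * m + 2 * q + 2 * p) *
      (((m : ℝ) + 2) * Real.log 2 - Real.log (3 / 2))) ≤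
      (3 * (q : ℝ) + 2 * p) * Real.log 2 * (((m : ℝ) + 1) * (3 * q * m + 2 * q + 2 * p)) := by
    have e : (3 * (q : ℝ) + 2 * p) * Real.log 2 * (((m : ℝ) + 1) * (3 * q * m + 2 * q + 2 * p)) -
        3 * (q : ℝ) * (((3 * q + 2 * p) * m + 2 * q + 2 * p) *
          (((m : ℝ) + 2) * Real.log 2 - Real.log (3 / 2))) =
        (m : ℝ) * (2 * (p : ℝ) * (2 * q + 2 * p) * Real.log 2 -
            3 * (q : ℝ) * (3 * q + 2 * p) * (Real.log 2 - Real.log (3 / 2))) +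
          (2 * (q : ℝ) + 2 * p) * (2 * p * Real.log 2 - 3 * q * (Real.log 2 - Real.log (3 / 2))) := by
      ring
    nlinarith [e, mul_nonneg hm0 hA, hB]
  -- unscramble the quotients
  rw [div_div_eq_mul_div, le_div_iff₀ hD]
  have e3 : (3 * (q : ℝ) + 2 * p) / (3 * q) * Real.log 2 * (((m : ℝ) + 1) * (3 * q * m + 2 * q + 2 * p)) =
      ((3 * (q : ℝ) + 2 * p) * Real.log 2 * (((m : ℝ) + 1) * (3 * q * m + 2 * q + 2 * p))) / (3 * q) := by
    field_simp
  rw [e3, le_div_iff₀ (by positivity)]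
  nlinarith [key]

/-- **Rate step.**  `t_m ≤ t < 1` and `log θ(p/q) ≤ C` give `(m+2) log 2 − log(3/2) ≤ C/(1−t)`.
[folklore] -/
theorem rate_step (p q m : ℕ) (hq : 0 < q) (h45 : 4 * q ≤ 5 * p) {C : ℝ}
    (hC : (3 * (q : ℝ) + 2 * p) / (3 * q) * Real.log 2 ≤ C) {t : ℝ} (ht1 : t < 1)
    (hmt : ((m : ℝ) * ((3 * q * m + 2 * q : ℕ) : ℝ)) /
      (((m : ℝ) + 1) * ((3 * q * m + 2 * q + 2 * p : ℕ) : ℝ) + ((0 : ℕ) : ℝ)) ≤ t) :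
    ((m : ℝ) + 2) * Real.log 2 - Real.log (3 / 2) ≤ C / (1 - t) := by
  have hq' : (0 : ℝ) < q := by exact_mod_cast hq
  have h1t : 0 < 1 - t := by linarith
  have hl2 := Real.log_two_gt_d9
  have hc0 : 0 ≤ (3 * (q : ℝ) + 2 * p) / (3 * q) * Real.log 2 := by positivity
  have hD : (0 : ℝ) < ((3 * (q : ℝ) + 2 * p) * m + 2 * q + 2 * p) /
      (((m : ℝ) + 1) * (3 * q * m + 2 * q + 2 * p)) := by positivity
  have h1 : 1 - t ≤ ((3 * (q : ℝ) + 2 * p) * m + 2 * q + 2 * p) /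
      (((m : ℝ) + 1) * (3 * q * m + 2 * q + 2 * p)) := by
    rw [← one_sub_t p q m _ _ rfl rfl hq]; linarith
  calc ((m : ℝ) + 2) * Real.log 2 - Real.log (3 / 2)
      ≤ ((3 * (q : ℝ) + 2 * p) / (3 * q) * Real.log 2) /
          (((3 * (q : ℝ) + 2 * p) * m + 2 * q + 2 * p) /
            (((m : ℝ) + 1) * (3 * q * m + 2 * q + 2 * p))) := rate_flat p q m hq h45
    _ ≤ C / (((3 * (q : ℝ) + 2 * p) * m + 2 * q + 2 * p) /
            (((m : ℝ) + 1) * (3 * q * m + 2 * q + 2 * p))) := div_le_div_of_nonneg_right hC hD.le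
    _ ≤ C / (1 - t) := div_le_div_of_nonneg_left (hc0.trans hC) h1t h1

/-! ## The tail clause of a band member -/

/-- **Tail clause of the pencil member `κ = p/q` at the flat rate.**  `0 < q`, `4q ≤ 5p ≤ 5q`,
`j₀ ≥ 16` with the band condition at `j₀`, and `log θ(p/q) = ((3q+2p)/(3q)) log 2 ≤ C`: for every
`t ∈ [t_{j₀}, 1)` some `r ∈ [1, e^{C/(1−t)}]` has `ω(1,t,r) = 1 + r` (`≤`).  For `t ∈ (t_j, t_{j+1}]`
take the exact point `j+1` (`band_tight`, band by `band_mono`): `ω(1,t,r_{j+1}) ≤ ω(1,t_{j+1},r_{j+1})`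
and `r_{j+1} ≤ (2/3) 2^{j+2} ≤ e^{C/(1−t_j)} ≤ e^{C/(1−t)}` (`rate_step`).
[cite: CoppersmithWinograd1990, §8] [cite: AlmanDuanVassilevskaWilliamsXuXuZhou2025, Thm. 3.2, §3.4] -/
theorem memberClause (p q j₀ : ℕ) (hq : 0 < q) (hpq : p ≤ q) (h45 : 4 * q ≤ 5 * p) (hj₀ : 16 ≤ j₀)
    (hA : ((1 + (p : ℝ) / q) * Real.log (5 / 2) + (1 - (p : ℝ) / q) * Real.log 2) * j₀ + 2 ≤
      (j₀ : ℝ) ^ 2 * ((5 / 2 + (p : ℝ) / q) * Real.log 2 - 5 / 2 * Real.log (5 / 2)))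
    {C : ℝ} (hC : (3 * (q : ℝ) + 2 * p) / (3 * q) * Real.log 2 ≤ C) :
    ∀ t : ℝ, ((j₀ : ℝ) * ((3 * q * j₀ + 2 * q : ℕ) : ℝ)) /
        (((j₀ : ℝ) + 1) * ((3 * q * j₀ + 2 * q + 2 * p : ℕ) : ℝ) + ((0 : ℕ) : ℝ)) ≤ t → t < 1 →
      ∃ r : ℝ, 1 ≤ r ∧ r ≤ Real.exp (C / (1 - t)) ∧ omegaRect ℂ 1 t r ≤ 1 + r := by
  classical
  intro t ht ht1
  have hq' : (0 : ℝ) < q := by exact_mod_cast hq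
  have hpq' : (p : ℝ) ≤ q := by exact_mod_cast hpq
  have hJ : (16 : ℝ) ≤ j₀ := by exact_mod_cast hj₀
  have hκ1 : (p : ℝ) / q ≤ 1 := by rw [div_le_one hq']; exact hpq'
  have hc0 := c₁_nonneg (by positivity : 0 ≤ (p : ℝ) / q) hκ1
  -- the band at every `j₀ + k`
  have hband : ∀ k : ℕ,
      ((1 + (p : ℝ) / q) * Real.log (5 / 2) + (1 - (p : ℝ) / q) * Real.log 2) * ((j₀ + k : ℕ) : ℝ) + 2 ≤
        ((j₀ + k : ℕ) : ℝ) ^ 2 * ((5 / 2 + (p : ℝ) / q) * Real.log 2 - 5 / 2 * Real.log (5 / 2)) :=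
    fun k => band_mono (by linarith) hc0 hA (by exact_mod_cast Nat.le_add_right j₀ k)
  -- the two count equations with a subtraction
  have hc₂ : ∀ m : ℕ, 1 ≤ m →
      2 * q * m * 2 ^ (m + 1) - (3 * q * m + 2 * q + 2 * p) + (3 * q * m + 2 * q + 2 * p) =
        2 * q * m * 2 ^ (m + 1) := fun m hm => Nat.sub_add_cancel (le_cnt_aux p q m hpq hm)
  have hc₄ : ∀ m : ℕ, 2 ≤ m → q * m - 2 * q + 2 * q = q * m := fun m hm =>
    Nat.sub_add_cancel (two_q_le q m hm)
  -- abscissae and ordinates of the exact points, as sequences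
  obtain ⟨T, hT⟩ : ∃ T : ℕ → ℝ, ∀ k, T k =
      (((j₀ + k : ℕ) : ℝ) * ((3 * q * (j₀ + k) + 2 * q : ℕ) : ℝ)) /
        ((((j₀ + k : ℕ) : ℝ) + 1) * ((3 * q * (j₀ + k) + 2 * q + 2 * p : ℕ) : ℝ) + ((0 : ℕ) : ℝ)) :=
    ⟨fun k => (((j₀ + k : ℕ) : ℝ) * ((3 * q * (j₀ + k) + 2 * q : ℕ) : ℝ)) /
        ((((j₀ + k : ℕ) : ℝ) + 1) * ((3 * q * (j₀ + k) + 2 * q + 2 * p : ℕ) : ℝ) + ((0 : ℕ) : ℝ)),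
      fun k => rfl⟩
  obtain ⟨R, hR⟩ : ∃ R : ℕ → ℝ, ∀ k, R k =
      ((((j₀ + k : ℕ) : ℝ) + 1) *
            ((2 * q * (j₀ + k) * 2 ^ (j₀ + k + 1) - (3 * q * (j₀ + k) + 2 * q + 2 * p) : ℕ) : ℝ) +
          ((3 * q * (j₀ + k) + 2 * q : ℕ) : ℝ) + ((q * (j₀ + k) - 2 * q : ℕ) : ℝ)) /
        ((((j₀ + k : ℕ) : ℝ) + 1) * ((3 * q * (j₀ + k) + 2 * q + 2 * p : ℕ) : ℝ) + ((0 : ℕ) : ℝ)) :=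
    ⟨fun k => ((((j₀ + k : ℕ) : ℝ) + 1) *
            ((2 * q * (j₀ + k) * 2 ^ (j₀ + k + 1) - (3 * q * (j₀ + k) + 2 * q + 2 * p) : ℕ) : ℝ) +
          ((3 * q * (j₀ + k) + 2 * q : ℕ) : ℝ) + ((q * (j₀ + k) - 2 * q : ℕ) : ℝ)) /
        ((((j₀ + k : ℕ) : ℝ) + 1) * ((3 * q * (j₀ + k) + 2 * q + 2 * p : ℕ) : ℝ) + ((0 : ℕ) : ℝ)),
      fun k => rfl⟩
  have hcert : ∀ k, omegaRect ℂ 1 (T k) (R k) ≤ 1 + R k := fun k => by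
    rw [hT, hR]; exact band_tight p q (j₀ + k) hq hpq (by omega) (hband k)
  have hR1 : ∀ k, 1 ≤ R k := fun k => by
    rw [hR]
    exact one_le_r p q (j₀ + k) _ _ _ _ rfl (hc₂ (j₀ + k) (by omega)) rfl (hc₄ (j₀ + k) (by omega))
      hq hpq (by omega)
  have hRle : ∀ k, R k ≤ 2 / 3 * (2 : ℝ) ^ (j₀ + k + 1) := fun k => by
    rw [hR]
    exact r_le_two_thirds p q (j₀ + k) _ _ _ _ rfl (hc₂ (j₀ + k) (by omega)) rfl
      (hc₄ (j₀ + k) (by omega)) hq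
  -- the abscissae exhaust `[0,1)`
  have hex : ∃ k : ℕ, t ≤ T k := by
    obtain ⟨k, hk⟩ := exists_nat_ge (2 / (1 - t))
    refine ⟨k, ?_⟩
    have h1s : 0 < 1 - t := by linarith
    have hjpos : (0 : ℝ) < ((j₀ + k : ℕ) : ℝ) := by
      have : (1 : ℝ) ≤ ((j₀ + k : ℕ) : ℝ) := by exact_mod_cast (by omega : 1 ≤ j₀ + k)
      linarith
    have hle := one_sub_t_le p q (j₀ + k) (3 * q * (j₀ + k) + 2 * q)
      (3 * q * (j₀ + k) + 2 * q + 2 * p) rfl rfl hq hpq (by omega)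
    have hk' : 2 / (1 - t) ≤ ((j₀ + k : ℕ) : ℝ) :=
      hk.trans (by push_cast; linarith [(Nat.cast_nonneg j₀ : (0 : ℝ) ≤ j₀)])
    have h2 : 2 / ((j₀ + k : ℕ) : ℝ) ≤ 1 - t := by
      rw [div_le_iff₀ hjpos]
      have := (div_le_iff₀ h1s).1 hk'
      linarith
    rw [hT]
    linarith
  have hspec := Nat.find_spec hex
  refine ⟨R (Nat.find hex), hR1 _, ?_, thinTight_of_le ℂ hspec (hcert _)⟩
  rcases Nat.eq_zero_or_pos (Nat.find hex) with h0 | hpos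
  · -- `t = t_{j₀}`: the member `j₀` itself
    rw [h0]
    have hrate := rate_step p q j₀ hq h45 hC ht1 ht
    calc R 0 ≤ 2 / 3 * (2 : ℝ) ^ (j₀ + 0 + 1) := hRle 0
      _ ≤ 2 / 3 * (2 : ℝ) ^ (j₀ + 2) :=
          mul_le_mul_of_nonneg_left (pow_le_pow_right₀ (by norm_num) (by omega)) (by norm_num)
      _ ≤ Real.exp (C / (1 - t)) := two_thirds_pow_le_exp hrate
  · obtain ⟨k, hk⟩ : ∃ k, Nat.find hex = k + 1 := ⟨Nat.find hex - 1, by omega⟩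
    have hlt : T k < t := by
      have := Nat.find_min hex (show k < Nat.find hex by omega)
      exact lt_of_not_ge this
    rw [hk]
    have hmt := hlt.le
    rw [hT] at hmt
    have hrate := rate_step p q (j₀ + k) hq h45 hC ht1 hmt
    calc R (k + 1) ≤ 2 / 3 * (2 : ℝ) ^ (j₀ + (k + 1) + 1) := hRle (k + 1)
      _ = 2 / 3 * (2 : ℝ) ^ (j₀ + k + 2) := by rw [show j₀ + (k + 1) + 1 = j₀ + k + 2 from by omega]
      _ ≤ Real.exp (C / (1 - t)) := two_thirds_pow_le_exp hrate

/-! ## Table: explicit tail clauses of six band members -/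

/-- `κ = 1`: from `t = 200/221 = 0.905` on at rate `(5/3) log 2 ≤ 1.1553` (band onset `j = 16`).
[cite: CoppersmithWinograd1990, §8] [cite: AlmanDuanVassilevskaWilliamsXuXuZhou2025, Thm. 3.2, §3.4] -/
theorem clause_1_1 : ∀ t : ℝ, (200 : ℝ) / 221 ≤ t → t < 1 →
    ∃ r : ℝ, 1 ≤ r ∧ r ≤ Real.exp (1.1553 / (1 - t)) ∧ omegaRect ℂ 1 t r ≤ 1 + r := by
  intro t ht ht1
  have hl2 := Real.log_two_gt_d9
  have hl2' := Real.log_two_lt_d9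
  have hP := log_five_halves_le_d7
  refine memberClause 1 1 16 (by norm_num) (by norm_num) (by norm_num) (by norm_num)
    (by push_cast; nlinarith) (by push_cast; linarith) t ?_ ht1
  convert ht using 1; norm_num

/-- `κ = 6/7`: from `t = 55335/57044 = 0.9700` on at rate `(11/7) log 2 ≤ 1.0893` (onset `j = 51`).
[cite: CoppersmithWinograd1990, §8] [cite: AlmanDuanVassilevskaWilliamsXuXuZhou2025, Thm. 3.2, §3.4] -/
theorem clause_6_7 : ∀ t : ℝ, (55335 : ℝ) / 57044 ≤ t → t < 1 →
    ∃ r : ℝ, 1 ≤ r ∧ r ≤ Real.exp (1.0893 / (1 - t)) ∧ omegaRect ℂ 1 t r ≤ 1 + r := by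
  intro t ht ht1
  have hl2 := Real.log_two_gt_d9
  have hl2' := Real.log_two_lt_d9
  have hP := log_five_halves_le_d7
  refine memberClause 6 7 51 (by norm_num) (by norm_num) (by norm_num) (by norm_num)
    (by push_cast; nlinarith) (by push_cast; linarith) t ?_ ht1
  convert ht using 1; norm_num

/-- `κ = 5/6`: from `t = 25576/26009 = 0.9834` on at rate `(14/9) log 2 ≤ 1.0783` (onset `j = 92`).
[cite: CoppersmithWinograd1990, §8] [cite: AlmanDuanVassilevskaWilliamsXuXuZhou2025, Thm. 3.2, §3.4] -/
theorem clause_5_6 : ∀ t : ℝ, (25576 : ℝ) / 26009 ≤ t → t < 1 →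
    ∃ r : ℝ, 1 ≤ r ∧ r ≤ Real.exp (1.0783 / (1 - t)) ∧ omegaRect ℂ 1 t r ≤ 1 + r := by
  intro t ht ht1
  have hl2 := Real.log_two_gt_d9
  have hl2' := Real.log_two_lt_d9
  have hP := log_five_halves_le_d7
  refine memberClause 5 6 92 (by norm_num) (by norm_num) (by norm_num) (by norm_num)
    (by push_cast; nlinarith) (by push_cast; linarith) t ?_ ht1
  convert ht using 1; norm_num

/-- `κ = 9/11`: from `t = 251823/253820 = 0.9921` on at rate `(17/11) log 2 ≤ 1.0713` (onset `j = 195`).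
[cite: CoppersmithWinograd1990, §8] [cite: AlmanDuanVassilevskaWilliamsXuXuZhou2025, Thm. 3.2, §3.4] -/
theorem clause_9_11 : ∀ t : ℝ, (251823 : ℝ) / 253820 ≤ t → t < 1 →
    ∃ r : ℝ, 1 ≤ r ∧ r ≤ Real.exp (1.0713 / (1 - t)) ∧ omegaRect ℂ 1 t r ≤ 1 + r := by
  intro t ht ht1
  have hl2 := Real.log_two_gt_d9
  have hl2' := Real.log_two_lt_d9
  have hP := log_five_halves_le_d7
  refine memberClause 9 11 195 (by norm_num) (by norm_num) (by norm_num) (by norm_num)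
    (by push_cast; nlinarith) (by push_cast; linarith) t ?_ ht1
  convert ht using 1; norm_num

/-- `κ = 13/16`: from `t = 2747264/2759799 = 0.99546` on at rate `(37/24) log 2 ≤ 1.0687`
(onset `j = 338`).
[cite: CoppersmithWinograd1990, §8] [cite: AlmanDuanVassilevskaWilliamsXuXuZhou2025, Thm. 3.2, §3.4] -/
theorem clause_13_16 : ∀ t : ℝ, (2747264 : ℝ) / 2759799 ≤ t → t < 1 →
    ∃ r : ℝ, 1 ≤ r ∧ r ≤ Real.exp (1.0687 / (1 - t)) ∧ omegaRect ℂ 1 t r ≤ 1 + r := by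
  intro t ht ht1
  have hl2 := Real.log_two_gt_d9
  have hl2' := Real.log_two_lt_d9
  have hP := log_five_halves_le_d7
  refine memberClause 13 16 338 (by norm_num) (by norm_num) (by norm_num) (by norm_num)
    (by push_cast; nlinarith) (by push_cast; linarith) t ?_ ht1
  convert ht using 1; norm_num

/-- `κ = 21/26`: from `t = 31683665/31737772 = 0.99830` on at rate `(20/13) log 2 ≤ 1.0664`
(onset `j = 901`) — within `0.0014` of the class ceiling `c₂ = 1.06505…`.
[cite: CoppersmithWinograd1990, §8] [cite: AlmanDuanVassilevskaWilliamsXuXuZhou2025, Thm. 3.2, §3.4] -/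
theorem clause_21_26 : ∀ t : ℝ, (31683665 : ℝ) / 31737772 ≤ t → t < 1 →
    ∃ r : ℝ, 1 ≤ r ∧ r ≤ Real.exp (1.0664 / (1 - t)) ∧ omegaRect ℂ 1 t r ≤ 1 + r := by
  intro t ht ht1
  have hl2 := Real.log_two_gt_d9
  have hl2' := Real.log_two_lt_d9
  have hP := log_five_halves_le_d7
  refine memberClause 21 26 901 (by norm_num) (by norm_num) (by norm_num) (by norm_num)
    (by push_cast; nlinarith) (by push_cast; linarith) t ?_ ht1
  convert ht using 1; norm_num

end Summit.MatrixMultiplication.MatrixMultiplication.Theorems.SaturationLadderBandClauses
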